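/-
Origin: expansion seat `planner-pub-hodgecm-pv02-g3-0`, handover #6 2026-08-18T06:03:53Z (`HOME/pub-hodgecm-pv02-g3/lean/Pv02g3/PerL34/S1StrengthCR.lean`, md5 b2a17704, 509 lines);
landed by the gen-6 packager in gate run 24 as `HodgeCM/PerL34/S1StrengthCR.lean` (stripped 2 #print/#check/#eval lines).
-/
/-
Origin: planner-pub-hodgecm-pv02-g3-0 (unit pub-hodgecm-pv02-g3, DAG-NODE PROVER #02 gen 3), 2026-08-18.
Proposed tree path: `HodgeCM/PerL34/S1StrengthCR.lean` (new, additive).  Imports: LANDED `HodgeCM.PerL34.CharSpansCR`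
(run 22) and pv03-g2's `HodgeCM.PerL34.StepsVacuity` (LANDED run 23).  KERNEL: nothing cited, nothing asserted.
Referee A round 15, P1 — S1 half, the CR binder.
-/
import Mathlib.LinearAlgebra.Finsupp.LSum
import Summits.HodgeConjecture.HodgeCM.PerL34.CharSpansCR
import Summits.HodgeConjecture.HodgeCM.PerL34.StepsVacuity_2

/-!
# Strength test of the CR binder `WeilStepsInputCR T` (referee A round 15, P1 — S1 half)

pv03-g2's `StepsVacuity` settles the tree-level half of referee A's P1: the binder `h33 : StepsPrintInput T` of
`perL_of_leaves'` (and `StepsInput`, `FormsInput`, `BallStepsInput`, `BallSpanStepsInput`, `CharSpanStepsInput`)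
is EQUIVALENT to hereditary A6, `StepsVacuity.Open_thetaWedgeHereditary T`.  Those binders have FREE carrier
fields (`X`, `W`, `Hol`, …), so a junk instance is cheap.  The question left to this seat (pv08-g3 05:37Z, pv03-g2
05:37Z) is whether the LATE binder `CharSpansCR.WeilStepsInputCR T` — whose dictionary is the honest one: forms on
`𝔹²`, frame readings on `U(2,1)`, `Hol := BallCR.Hol` = one-forms `ℂ`-differentiable at every point of the ball,
(X1) stated against the concrete `BallCR.ballFD`, a Weil typing `P43WeilModel.WeilTyping` of every theta-kernel
model, N10 in invariant form, `Δ` dense in `U(2,1)` — is STRICTLY stronger.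

## Verdict (this file)

* LOWER BOUND (kernel, unconditional): `WeilStepsInputCR T → Open_thetaWedgeHereditary T ∧ CharsNonempty T`
  given `T.Open_chars` (node N31, needed to read the dictionary Props at all), where
  `CharsNonempty T := ∀ good ctx, Nonempty (T.t12 V c).X` (forced by the package's `SomeNonzero`).
* UPPER BOUND (kernel REDUCTION): `SplitHolConfig → CharsNonempty T → Open_thetaWedgeHereditary T →
  WeilStepsInputCR T`, by an explicit junk `WeilPackageCR` (below).  Here `SplitHolConfig` is a `T`-INDEPENDENT
  statement about the unit ball ONLY: two non-zero `ℂ`-subspaces `𝒱₀, 𝒱₁` of holomorphic one-forms on `𝔹²` with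
  `𝒱₀ ⊓ 𝒱₁ = ⊥` whose frame readings are stable under all left translations by `U(2,1)`.  (The companion file
  `SplitHolForms.lean` of this unit constructs one from the `U(2,1)`-translates of `dz₀` and of `z₀dz₁ - z₁dz₀`;
  until it lands, `SplitHolConfig` is an explicit hypothesis — it contains no `T`, no PerL object and no cited fact.)
* Hence, given `SplitHolConfig` and `T.Open_chars`:
  `WeilStepsInputCR T ↔ Open_thetaWedgeHereditary T ∧ CharsNonempty T`, and the same for pv03's `WeilStepsInput T`
  and pv02-g2's `CharSpanStepsInput T`.  The CR binder is therefore NOT strictly stronger than hereditary A6 in any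
  `T`-dependent way: modulo the nonemptiness of the character sets it is hereditary A6 again.  Everything the S1 chain
  types (Weil typing, (X1)/(X2), N10, real approximation) is satisfiable by junk once A6 is given; the open input A6
  (= PerL Prop. 4.3's conclusion) is untouched by the kernel theorems of the S1 chain.

## The junk package (per good context, given hereditary A6 at `Γ₀`, `χ₀ ∈ X`, and `C : SplitHolConfig`)

For `i = 0, 1` let `S₀ⁱ := R(𝒱ᵢ) ⊂ (U(2,1) → ℂ²)` and take the "Schwartz space" `Sᵢ := U(2,1) →₀ S₀ⁱ` (finitely
supported functions), `G_c := Unit`, `G_f := U(2,1)` (as an abstract group), `Γ := {(δ, (), δ)}` (so `Δ = ⊤`),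
`ωinf g : δ_x ⊗ Φ ↦ δ_{gx} ⊗ Φ`, `ωf h : δ_x ⊗ Φ ↦ δ_x ⊗ Φ(h⁻¹ ·)`, `ωc := id`, `Θ : δ_x ⊗ Φ ↦ Φ(x)`,
`theta φ (g, c, h) := Θ (ωinf g (ωf h φ))`, `K_c := Unit`, `ρ () :=` the projection onto the `δ_1`-component,
`P := (U(2,1) → ℂ²)`, `ρP () := id`.  Then `isotypic ρ ρP = {δ_1 ⊗ Φ}`, `fixedSub ωc = ⊤`, so
`Θ[𝔭₊] = theta {δ_1 ⊗ Φ}` and `u_{theta (δ_1 ⊗ Φ)} = Φ ∈ R(𝒱ᵢ) ⊂ BallCR.Hol` ((X1) for `ballFD`); all nine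
`WeilTyping` laws and N10 (`Θ ∘ ωinf δ ∘ ωf δ = Θ`) hold by one-line computations on the basis `δ_x ⊗ Φ`; the
generators of the induced forms model are `gen i χ = 𝒱ᵢ`, and the dictionary Props are met by the junk class map
`cls Γ' u := [u = 0] z | [u ∈ 𝒱₁] ω₂ | ω₁` from the hereditary A6 data at `Γ' ≤ Γ₀` (well defined BECAUSE
`𝒱₀ ⊓ 𝒱₁ = ⊥`), `lvl := Γ₀`.
-/

noncomputable section

open Complex

namespace HodgeCM
namespace PerL34
namespace S1StrengthCR

open HodgeCM.PerL34.BallModel HodgeCM.PerL34.BallSpans HodgeCM.PerL34.BallFrame HodgeCM.PerL34.CharSpans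
  HodgeCM.PerL34.CharSpansWeil HodgeCM.PerL34.CharSpansCR HodgeCM.PerL34.WedgeNonvanishing
  HodgeCM.PerL34.WedgeToClasses HodgeCM.PerL34.P43WeilModel HodgeCM.PerL34.P43Isotypic HodgeCM.PerL34.StepsVacuity

variable {U : Universe} (T : U.ThetaModel)

/-! ## 1. The `T`-independent residual and the lower bound -/

/-- **The `T`-independent residual**: two non-zero, disjoint `ℂ`-subspaces of holomorphic one-forms on `𝔹²` whose
frame readings are stable under every left translation `Φ ↦ Φ(g ·)` of `U(2,1)`. -/
structure SplitHolConfig where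
  /-- the two families of one-forms on the ball -/
  𝒱 : Fin 2 → Submodule ℂ (Ball → (Fin 2 → ℂ))
  hol : ∀ i, 𝒱 i ≤ BallCR.holForms
  ne_bot : ∀ i, 𝒱 i ≠ ⊥
  inf_eq_bot : 𝒱 0 ⊓ 𝒱 1 = ⊥
  stable : ∀ (i : Fin 2) (g : U21), ∀ Φ ∈ (𝒱 i).map R, P43.lTransl g Φ ∈ (𝒱 i).map R

/-- In every good context the side-(12) character set is non-empty. -/
def CharsNonempty : Prop :=
  ∀ {L : CMField} {ι₁ : L →+* ℂ} (V : HermSpace3 L ι₁) (c : SeesawCtx L), T.GoodCtx ι₁ c → Nonempty (T.t12 V c).X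

/-- (Ported verbatim from the HodgeCMPerL package; no docstring in the source.) -/
theorem charsNonempty_of_charSpans (h : CharSpanStepsInput T) : CharsNonempty T := by
  intro L ι₁ V c hc
  obtain ⟨M, hG, -⟩ := h V c hc
  obtain ⟨χ, -⟩ := hG.2.2.2.2 0
  exact ⟨χ⟩

/-- (Ported verbatim from the HodgeCMPerL package; no docstring in the source.) -/
theorem charsNonempty_of_CR (h : WeilStepsInputCR T) : CharsNonempty T :=
  charsNonempty_of_charSpans T (charSpanStepsInput_of_CR T h)

/-- **Lower bound**: the CR binder gives hereditary A6 (pv03-g2 `StepsVacuity.hereditary_of_charSpans`). -/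
theorem hereditary_of_CR (hch : T.Open_chars) (h : WeilStepsInputCR T) : Open_thetaWedgeHereditary T :=
  hereditary_of_charSpans T hch (charSpanStepsInput_of_CR T h)

/-! ## 2. The junk Weil package over a `SplitHolConfig` -/

namespace Junk

variable (C : SplitHolConfig)

/-- `S₀ⁱ := R(𝒱ᵢ)`, frame readings of the forms of the `i`-th family. -/
def S₀ (i : Fin 2) : Submodule ℂ (U21 → (Fin 2 → ℂ)) := (C.𝒱 i).map R

/-- The model space `Sᵢ := U(2,1) →₀ S₀ⁱ`. -/
abbrev Sp (i : Fin 2) : Type := U21 →₀ ↥(S₀ C i)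

variable (i : Fin 2)

/-- `ωinf g : δ_x ⊗ Φ ↦ δ_{gx} ⊗ Φ`. -/
def ωinf (g : U21) : Sp C i →ₗ[ℂ] Sp C i := Finsupp.lmapDomain (↥(S₀ C i)) ℂ fun x : U21 => g * x

/-- `Φ ↦ Φ(h⁻¹ ·)` on `S₀ⁱ`. -/
def L (h : U21) : ↥(S₀ C i) →ₗ[ℂ] ↥(S₀ C i) :=
  (P43.lTransl h⁻¹).restrict fun Φ hΦ => C.stable i h⁻¹ Φ hΦ

/-- (Ported verbatim from the HodgeCMPerL package; no docstring in the source.) -/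
@[simp] theorem L_coe_apply (h : U21) (s : ↥(S₀ C i)) (y : U21) :
    ((L C i h s : ↥(S₀ C i)) : U21 → (Fin 2 → ℂ)) y = (s : U21 → (Fin 2 → ℂ)) (h⁻¹ * y) := rfl

/-- (Ported verbatim from the HodgeCMPerL package; no docstring in the source.) -/
theorem L_mul (h h' : U21) : L C i (h' * h) = L C i h' ∘ₗ L C i h := by
  apply LinearMap.ext
  intro s
  apply Subtype.ext
  funext y
  simp only [L_coe_apply, LinearMap.coe_comp, Function.comp_apply, mul_inv_rev, mul_assoc]

/-- `ωf h : δ_x ⊗ Φ ↦ δ_x ⊗ Φ(h⁻¹ ·)`. -/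
def ωf (h : U21) : Sp C i →ₗ[ℂ] Sp C i := Finsupp.mapRange.linearMap (L C i h)

/-- `Θ : δ_x ⊗ Φ ↦ Φ(x)`. -/
def Θ : Sp C i →ₗ[ℂ] (Fin 2 → ℂ) :=
  Finsupp.lsum ℂ fun x : U21 => (LinearMap.proj x : (U21 → (Fin 2 → ℂ)) →ₗ[ℂ] (Fin 2 → ℂ)) ∘ₗ (S₀ C i).subtype

/-- `theta φ (g, c, h) := Θ (ωinf g (ωf h φ))`. -/
def theta : Sp C i →ₗ[ℂ] (U21 × Unit × U21 → (Fin 2 → ℂ)) :=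
  LinearMap.pi fun y => Θ C i ∘ₗ ωinf C i y.1 ∘ₗ ωf C i y.2.2

/-- `ρ () :=` the projection onto the `δ_1`-component. -/
def ρK (_ : Unit) : Sp C i →ₗ[ℂ] Sp C i :=
  (Finsupp.lsingle (1 : U21) : ↥(S₀ C i) →ₗ[ℂ] Sp C i) ∘ₗ Finsupp.lapply (1 : U21)

/-- `ρP () := id` on `P := (U(2,1) → ℂ²)`. -/
def ρP (_ : Unit) : (U21 → (Fin 2 → ℂ)) →ₗ[ℂ] (U21 → (Fin 2 → ℂ)) := LinearMap.id

/-- `ωc := id`. -/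
def ωc (_ : Unit) : Sp C i →ₗ[ℂ] Sp C i := LinearMap.id

/-- The `P`-isotypic subspace for `ρ` (elaborated WITHOUT an expected type: the `AddCommGroup`-path instances). -/
def Iso := isotypic (S := Sp C i) (ρK C i) ρP

/-- The vectors fixed by `ωc` (all of them). -/
def Fix := fixedSub (S := Sp C i) (ωc C i)

/-- `Θ[𝔭₊]`'s source: `isotypic ρ ρP ⊓ fixedSub ωc`. -/
def Ptype : Submodule ℂ (Sp C i) := Iso C i ⊓ Fix C i

/-- The junk theta-kernel model of the `i`-th family. -/
def Mk : P43Forms.ThetaKernelData U21 Unit U21 (Fin 2 → ℂ) (Sp C i) where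
  ωf := ωf C i
  ωc := ωc C i
  theta := theta C i
  Ptype := Ptype C i

/-! ### Computations on the basis `δ_x ⊗ Φ` -/

/-- (Ported verbatim from the HodgeCMPerL package; no docstring in the source.) -/
@[simp] theorem Θ_single (x : U21) (s : ↥(S₀ C i)) :
    Θ C i (Finsupp.single x s) = (s : U21 → (Fin 2 → ℂ)) x := by
  simp [Θ, Finsupp.lsum_single]

/-- (Ported verbatim from the HodgeCMPerL package; no docstring in the source.) -/
@[simp] theorem ωinf_single (g x : U21) (s : ↥(S₀ C i)) :
    ωinf C i g (Finsupp.single x s) = Finsupp.single (g * x) s := by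
  simp [ωinf, Finsupp.mapDomain_single]

/-- (Ported verbatim from the HodgeCMPerL package; no docstring in the source.) -/
@[simp] theorem ωf_single (h x : U21) (s : ↥(S₀ C i)) :
    ωf C i h (Finsupp.single x s) = Finsupp.single x (L C i h s) := by
  simp [ωf]

/-- (Ported verbatim from the HodgeCMPerL package; no docstring in the source.) -/
@[simp] theorem ωc_apply (u : Unit) (φ : Sp C i) : ωc C i u φ = φ := rfl

/-- (Ported verbatim from the HodgeCMPerL package; no docstring in the source.) -/
theorem theta_apply (φ : Sp C i) (y : U21 × Unit × U21) :
    theta C i φ y = Θ C i (ωinf C i y.1 (ωf C i y.2.2 φ)) := rfl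

/-- (Ported verbatim from the HodgeCMPerL package; no docstring in the source.) -/
theorem theta_single_one (s : ↥(S₀ C i)) (y : U21 × Unit × U21) :
    theta C i (Finsupp.single 1 s) y = (s : U21 → (Fin 2 → ℂ)) (y.2.2⁻¹ * y.1) := by
  rw [theta_apply, ωf_single, ωinf_single, Θ_single, mul_one, L_coe_apply]

/-- (Ported verbatim from the HodgeCMPerL package; no docstring in the source.) -/
theorem uEval_theta_single_one (s : ↥(S₀ C i)) :
    P43Forms.uEval (theta C i (Finsupp.single 1 s)) = (s : U21 → (Fin 2 → ℂ)) := by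
  funext g
  rw [P43Forms.uEval_apply, theta_single_one, inv_one, one_mul]

/-- (Ported verbatim from the HodgeCMPerL package; no docstring in the source.) -/
@[simp] theorem ρK_single (u : Unit) (x : U21) (s : ↥(S₀ C i)) :
    ρK C i u (Finsupp.single x s) = Finsupp.single 1 (Finsupp.single x s 1) := by
  simp [ρK]

/-! ### The `K`-type: `isotypic ρ ρP ⊓ fixedSub ωc = {δ_1 ⊗ Φ}` -/

/-- (Ported verbatim from the HodgeCMPerL package; no docstring in the source.) -/
theorem mem_fix (φ : Sp C i) : φ ∈ Fix C i := fun _ => rfl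

/-- (Ported verbatim from the HodgeCMPerL package; no docstring in the source.) -/
theorem iso_le : Iso C i ≤ LinearMap.range (Finsupp.lsingle (1 : U21) : ↥(S₀ C i) →ₗ[ℂ] Sp C i) := by
  apply iSup_le
  rintro ⟨f, hf⟩
  rintro φ ⟨p, rfl⟩
  have h := LinearMap.congr_fun (hf ()) p
  simp only [LinearMap.coe_comp, Function.comp_apply, ρP, LinearMap.id_apply, ρK,
    Finsupp.lsingle_apply, Finsupp.lapply_apply] at h
  exact ⟨f p 1, by rw [Finsupp.lsingle_apply]; exact h.symm⟩

/-- (Ported verbatim from the HodgeCMPerL package; no docstring in the source.) -/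
theorem single_mem_iso (s : ↥(S₀ C i)) : (Finsupp.single (1 : U21) s : Sp C i) ∈ Iso C i := by
  let f : (U21 → (Fin 2 → ℂ)) →ₗ[ℂ] Sp C i :=
    (Finsupp.lsingle (1 : U21) : ↥(S₀ C i) →ₗ[ℂ] Sp C i) ∘ₗ
      (((LinearMap.proj (0 : Fin 2) : (Fin 2 → ℂ) →ₗ[ℂ] ℂ) ∘ₗ
        (LinearMap.proj (1 : U21) : (U21 → (Fin 2 → ℂ)) →ₗ[ℂ] (Fin 2 → ℂ))).smulRight s)
  have hf : IsKHom (S := Sp C i) (ρK C i) ρP f := by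
    intro u
    apply LinearMap.ext
    intro p
    simp [f, ρP, ρK]
  have hp : f (fun _ => Pi.single 0 1) = Finsupp.single (1 : U21) s := by
    simp [f]
  -- (closed term first, then `exact`: elaborating `isotypic` against an expected type is slow)
  have h := mem_isotypic_of_range (S := Sp C i) (ρK C i) ρP hf (fun _ => Pi.single 0 1)
  rw [hp] at h
  exact h

/-- (Ported verbatim from the HodgeCMPerL package; no docstring in the source.) -/
theorem mem_iso_iff (φ : Sp C i) : φ ∈ Iso C i ↔ ∃ s : ↥(S₀ C i), Finsupp.single 1 s = φ := by
  constructor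
  · intro h
    obtain ⟨s, hs⟩ := iso_le C i h
    exact ⟨s, by simpa only [Finsupp.lsingle_apply] using hs⟩
  · rintro ⟨s, rfl⟩
    exact single_mem_iso C i s

/-- (Ported verbatim from the HodgeCMPerL package; no docstring in the source.) -/
theorem mem_ptype_iff (φ : Sp C i) : φ ∈ Ptype C i ↔ ∃ s : ↥(S₀ C i), Finsupp.single 1 s = φ := by
  change φ ∈ Iso C i ⊓ Fix C i ↔ _
  rw [Submodule.mem_inf, mem_iso_iff]
  exact ⟨fun h => h.1, fun h => ⟨h, mem_fix C i φ⟩⟩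

/-- (Ported verbatim from the HodgeCMPerL package; no docstring in the source.) -/
theorem mem_thetaP_iff (F : U21 × Unit × U21 → (Fin 2 → ℂ)) :
    F ∈ (Mk C i).ThetaP ↔ ∃ s : ↥(S₀ C i), theta C i (Finsupp.single 1 s) = F := by
  change F ∈ (Ptype C i).map (theta C i) ↔ _
  rw [Submodule.mem_map]
  constructor
  · rintro ⟨φ, hφ, rfl⟩
    obtain ⟨s, rfl⟩ := (mem_ptype_iff C i φ).mp hφ
    exact ⟨s, rfl⟩
  · rintro ⟨s, rfl⟩
    exact ⟨Finsupp.single 1 s, (mem_ptype_iff C i _).mpr ⟨s, rfl⟩, rfl⟩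

/-- **(X1) for `ballFD`**: every `u_F`, `F ∈ Θ[𝔭₊]`, is (the frame reading of) a holomorphic one-form. -/
theorem hX1 : P43Forms.ThetaPKilledByPminus BallCR.ballFD (Mk C i) := by
  rw [thetaPKilled_ballFD_iff]
  intro F hF
  obtain ⟨s, rfl⟩ := (mem_thetaP_iff C i F).mp hF
  rw [uEval_theta_single_one, BallCR.ballFD_Hol]
  exact Submodule.map_mono (C.hol i) s.2

/-- A non-zero element of `Θ[𝔭₊]`. -/
theorem thetaP_ne_bot : (Mk C i).ThetaP ≠ ⊥ := by
  obtain ⟨u, hu, hu0⟩ := (Submodule.ne_bot_iff _).mp (C.ne_bot i)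
  have hs : R u ∈ S₀ C i := Submodule.mem_map_of_mem hu
  rw [Submodule.ne_bot_iff]
  refine ⟨theta C i (Finsupp.single 1 ⟨R u, hs⟩), (mem_thetaP_iff C i _).mpr ⟨_, rfl⟩, fun h0 => hu0 ?_⟩
  have h1 := uEval_theta_single_one C i ⟨R u, hs⟩
  rw [h0, map_zero] at h1
  exact R_injective (by rw [map_zero]; exact h1.symm)

/-! ### The Weil typing -/

/-- All nine laws of pv14's `WeilTyping`, by computation on the basis. -/
def typing : WeilTyping (Mk C i) (ωinf C i) (ρK C i) ρP where
  Θ := Θ C i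
  hθ _ _ := rfl
  hmulI g g' := by
    change Finsupp.lmapDomain _ ℂ (fun x : U21 => g' * g * x) = _
    rw [show (fun x : U21 => g' * g * x) = (fun x : U21 => g' * x) ∘ (fun x : U21 => g * x) from
      funext fun x => mul_assoc _ _ _]
    exact Finsupp.lmapDomain_comp _ _ _ _
  hmulC _ _ := rfl
  hmulF h h' := by
    change ωf C i (h' * h) = ωf C i h' ∘ₗ ωf C i h
    rw [ωf, L_mul, Finsupp.mapRange.linearMap_comp]
    rfl
  hcommIC _ _ := rfl
  hcommIF g h := by
    apply Finsupp.lhom_ext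
    intro x s
    change ωinf C i g (ωf C i h (Finsupp.single x s)) = ωf C i h (ωinf C i g (Finsupp.single x s))
    rw [ωf_single, ωinf_single, ωinf_single, ωf_single]
  hcommCF _ _ := rfl
  hcommK h k := by
    apply Finsupp.lhom_ext
    intro x s
    change ωf C i h (ρK C i k (Finsupp.single x s)) = ρK C i k (ωf C i h (Finsupp.single x s))
    rw [ρK_single, ωf_single, ωf_single, ρK_single]
    by_cases hx : x = 1
    · subst hx
      rw [Finsupp.single_eq_same, Finsupp.single_eq_same]
    · rw [Finsupp.single_apply, Finsupp.single_apply, if_neg hx, if_neg hx, map_zero]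
  hP := rfl

/-! ### `Γ := {(δ, (), δ)}`, N10 in invariant form, `Δ = ⊤` -/

/-- The diagonal `δ ↦ (δ, (), δ)`. -/
def diag : U21 →* U21 × Unit × U21 := (MonoidHom.id U21).prod ((1 : U21 →* Unit).prod (MonoidHom.id U21))

/-- (Ported verbatim from the HodgeCMPerL package; no docstring in the source.) -/
@[simp] theorem diag_apply (δ : U21) : diag δ = (δ, (), δ) := rfl

/-- `Γ := {(δ, (), δ) : δ ∈ U(2,1)}`. -/
def Γd : Subgroup (U21 × Unit × U21) := diag.range

/-- (Ported verbatim from the HodgeCMPerL package; no docstring in the source.) -/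
theorem hΘ (γ : U21 × Unit × U21) (hγ : γ ∈ Γd) :
    Θ C i ∘ₗ (ωinf C i γ.1 ∘ₗ (Mk C i).ωc γ.2.1 ∘ₗ (Mk C i).ωf γ.2.2) = Θ C i := by
  obtain ⟨δ, rfl⟩ := hγ
  apply Finsupp.lhom_ext
  intro x s
  change Θ C i (ωinf C i δ (ωf C i δ (Finsupp.single x s))) = Θ C i (Finsupp.single x s)
  rw [ωf_single, ωinf_single, Θ_single, Θ_single, L_coe_apply, inv_mul_cancel_left]

end Junk

/-! ## 3. The junk `CharLineSpansCR` and its dictionary -/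

namespace Junk

variable {T}
variable {L : CMField} {ι₁ : L →+* ℂ} {V : HermSpace3 L ι₁} {c : SeesawCtx L}

/-- Hereditary A6 below `Γ₀` in the context `(V, c)` (the matrix of `Open_thetaWedgeHereditary`). -/
def HeredAt (T : U.ThetaModel) (V : HermSpace3 L ι₁) (c : SeesawCtx L) (Γ₀ : Level V) : Prop :=
  ∀ Γ : Level V, Γ.Γ ≤ Γ₀.Γ →
    (∃ ω₁ ∈ T.Theta V c 0 Γ, ∃ ω₂ ∈ T.Theta V c 1 Γ, U.cup2C (U.pms L ι₁ V Γ) 1 ω₁ ω₂ ≠ 0) ∧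
      (T.Theta V c 0 Γ ∩ T.Theta V c 1 Γ).Nonempty

variable (C : SplitHolConfig) {Γ₀ : Level V} (hC : HeredAt T V c Γ₀)
include hC

open Classical in
/-- The junk class map: `0 ↦` a class in `Θ₀ ∩ Θ₁`, a non-zero form of `𝒱₁ ↦ ω₂`, anything else `↦ ω₁`. -/
def cls (Γ' : Level V) (u : Ball → (Fin 2 → ℂ)) : U.CohC (U.pms L ι₁ V Γ') 1 :=
  if h : Γ'.Γ ≤ Γ₀.Γ then
    if u = 0 then (hC Γ' h).2.choose
    else if u ∈ C.𝒱 1 then (hC Γ' h).1.choose_spec.2.choose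
    else (hC Γ' h).1.choose
  else 0

/-- (Ported verbatim from the HodgeCMPerL package; no docstring in the source.) -/
theorem cls_zero {Γ' : Level V} (h : Γ'.Γ ≤ Γ₀.Γ) :
    cls C hC Γ' 0 ∈ T.Theta V c 0 Γ' ∧ cls C hC Γ' 0 ∈ T.Theta V c 1 Γ' := by
  simp only [cls, dif_pos h, if_true]
  exact (hC Γ' h).2.choose_spec

/-- (Ported verbatim from the HodgeCMPerL package; no docstring in the source.) -/
theorem cls_of_mem_one {Γ' : Level V} (h : Γ'.Γ ≤ Γ₀.Γ) {u : Ball → (Fin 2 → ℂ)} (hu : u ∈ C.𝒱 1)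
    (hu0 : u ≠ 0) : cls C hC Γ' u = (hC Γ' h).1.choose_spec.2.choose := by
  simp only [cls, dif_pos h, if_neg hu0, if_pos hu]


-- port_pkg: scope closed for this part
end Junk
end S1StrengthCR
end PerL34
end HodgeCM
end
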